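import Summits.CriticalPhenomena.SAWScalingLimit.Theorems.SAWLoopFugacityFlowAvoidanceLimitFatPathHarnack
import Literature.Probability.LatticeModels.KilledWalkBoxHitting
import Literature.Probability.LatticeModels.KilledWalkHubFactorisation
import HarnessLib

/-!
# Goodness of fat wall sites: the factorisation upper bound along a fat path to the hub

Sub-problem `CriticalPhenomena/SAWScalingLimit`, crux `AvoidanceLimit`, line `symplectic-fermion-anchor`
(lead c7), stub `stub_germTwoSided` (Chelkak 2016 Prop. 3.3, the FAT part of a wall). For the edge-killed walk
`Gr ≤ ℤ²` in a finite region `Λ`, a kept walk `π` from the hub centre `z` to a site `w`, every site of which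
carries a clean frame `mW v k ⊆ Λ` (all lattice edges present) and stays in the box `sqBox z N`, and an exit
`x ∉ Λ`: (i) `P_Λ(w,x) · (c_*/2)^E ≤ P_Λ(z,x)` — the Harnack chain of `harnack_fatPath` run along the reversed
walk, with the confining box centred at its endpoint (`fatSite_harnack_end`); (ii)
`(c_*/2)^E ≤ hitProb_Λ(mB z k)(w)` (`fatSite_hubHit`): a Harnack chain for the hitting probability of the hub
box whose steps are the annulus maneuver `hitProb_chain_step` between path sites at sup-distance exactly `24k`
(found by discrete continuity along `π`), paid once per cell of side `24k` (packing, not length), and started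
near the hub by a rectangle exit estimate (`fatSite_arm`: the hitting probability is
`≥ exitConst 4 3 1 ≥ 2^{-10}` on the vertical arms of the hub box) followed by one maneuver (`fatSite_nearHub`);
`E = 2 (N/(6k) + 2)² + 2` as in `harnack_fatPath`. Hence (iii) the site `w` is GOOD:
`P_Λ(w,x) ≤ (2/c_*)^{2E} · P_Λ(z,x) · hitProb_Λ(mB z k)(w)` — the input of `killedPoisson_le_of_goodSeparator`
for the fat wall sites. [cite: Chelkak2016, Proposition 3.3 (Harnack chain along `L'`)]
-/

noncomputable section

open scoped Classical
open Literature.Probability.LatticeModels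

namespace Summit.CriticalPhenomena.SAWScalingLimit.Theorems.AvoidanceLimit.Anchor

variable {Gr : SimpleGraph (Site 2)}

open Real in
/-- **The arm constant is not small**: `1/1024 ≤ exitConst 4 3 1 = √3 e^{-3π/4} / (4 cosh(π/2)) ≤ 1`
(crude bounds `√3 ∈ [1.7, 2]`, `e < 3`, `π ≤ 4`). [folklore] -/
theorem fatSite_exitConst_bounds : (1 : ℝ) / 1024 ≤ exitConst 4 3 1 ∧ exitConst 4 3 1 ≤ 1 := by
  have hs : (17 : ℝ) / 10 ≤ Real.sqrt 3 := by rw [Real.le_sqrt (by norm_num) (by norm_num)]; norm_num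
  have hs' : Real.sqrt 3 ≤ 2 := by rw [Real.sqrt_le_left (by norm_num)]; norm_num
  obtain ⟨he1, hpi', hpi⟩ := And.intro Real.exp_one_lt_three (And.intro Real.pi_le_four Real.pi_pos)
  have hcosh : cosh (π / 2) ≤ 9 := by
    rw [Real.cosh_eq]
    have h1 : exp (π / 2) ≤ exp 2 := Real.exp_le_exp.2 (by linarith)
    have h2 : exp (-(π / 2)) ≤ exp 2 := Real.exp_le_exp.2 (by linarith)
    have h3 : exp 2 = exp 1 * exp 1 := by rw [← Real.exp_add]; norm_num
    nlinarith [Real.exp_pos 1]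
  have hexp : (1 : ℝ) / 27 ≤ exp (-(π * 3 / 4)) := by
    have h1 : exp (-3) ≤ exp (-(π * 3 / 4)) := Real.exp_le_exp.2 (by linarith)
    have h3 : exp (-3) * (exp 1 * exp 1 * exp 1) = 1 := by
      rw [← Real.exp_add, ← Real.exp_add, ← Real.exp_add]; norm_num
    have h0 := (Real.exp_pos 1).le
    have hE : exp 1 * exp 1 * exp 1 ≤ 27 := le_trans (by gcongr : _ ≤ (3 : ℝ) * 3 * 3) (by norm_num)
    refine le_trans ?_ h1
    rw [eq_inv_of_mul_eq_one_left h3, one_div]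
    exact inv_anti₀ (by positivity) hE
  have hexp1 : exp (-(π * 3 / 4)) ≤ 1 := Real.exp_le_one_iff.2 (by nlinarith)
  have hform : exitConst 4 3 1 = Real.sqrt 3 * exp (-(π * 3 / 4)) / (4 * cosh (π / 2)) := by
    unfold exitConst modeRateConst; push_cast; field_simp
  rw [hform]
  have hc1 : 1 ≤ cosh (π / 2) := Real.one_le_cosh _
  have hc0 : 0 < 4 * cosh (π / 2) := by positivity
  constructor
  · rw [div_le_div_iff₀ (by norm_num) hc0]
    nlinarith [mul_le_mul hs hexp (by norm_num) (Real.sqrt_nonneg 3)]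
  · rw [div_le_one hc0]
    nlinarith [mul_le_mul hs' hexp1 (Real.exp_pos _).le (by norm_num : (0:ℝ) ≤ 2)]

/-- **The arms of the hub.** If the frame `mW z k` is clean and inside `Λ`, the probability to
hit the hub box `mB z k` before leaving `Λ` is at least `exitConst 4 3 1` on the vertical segment
through `z` at heights `12k < |y₁ - z₁| ≤ 36k`: the one-step exit bound of a `48k × 36k` lattice
rectangle standing on the box (`exit_bottom` / `exit_top`, depth `12k`, scale-free constant).
[cite: Chelkak2016, §3.2 (proof of Prop. 3.3)] -/
theorem fatSite_arm {Λ : Set (Site 2)} (hΛ : Λ.Finite) {z : Site 2} {k : ℕ} (hk : 0 < k)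
    (hW : mW z k ⊆ Λ) (hclean : ∀ v ∈ mW z k, ∀ e : SRW.Dir 2, Gr.Adj v (v + SRW.stepVec e))
    {y : Site 2} (hy0 : y 0 = z 0) (hy1 : 12 * (k : ℤ) < |y 1 - z 1|) (hy2 : |y 1 - z 1| ≤ 36 * k) :
    exitConst 4 3 1 ≤ hitProb Gr Λ (mB z k) y := by
  set u := hitProb Gr Λ (mB z k) with hu
  have hu0 : ∀ w, 0 ≤ u w := hitProb_nonneg hΛ
  have hk12 : 0 < 12 * k := by omega
  -- `u` is lattice harmonic on clean regions avoiding the box, and `= 1` on the box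
  have harm : ∀ R : Set (Site 2), R ⊆ mW z k → (∀ v ∈ R, v ∉ mB z k) → IsLatticeHarmonicOn u R :=
    fun R hR hRB => (isKilledHarmonicOn_iff_isLatticeHarmonicOn fun v hv => hclean v (hR hv)).1
      ((hitProb_harmonicOn hΛ).mono fun v hv => ⟨hW (hR hv), hRB v hv⟩)
  have hbox : ∀ w : Site 2, z 0 - 12 * k ≤ w 0 → w 0 ≤ z 0 + 12 * k → z 1 - 12 * k ≤ w 1 →
      w 1 ≤ z 1 + 12 * k → (1 : ℝ) ≤ u w := fun w h0 h0' h1 h1' => by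
    rw [hu, hitProb_of_mem (show w ∈ mB z k from
      ⟨abs_le.2 ⟨by omega, by omega⟩, abs_le.2 ⟨by omega, by omega⟩⟩)]
  rw [← one_mul (exitConst 4 3 1), ← MStep.exitConst_scale (w := 4) (h := 3) (by norm_num) hk12]
  rw [abs_le] at hy2
  rw [lt_abs, neg_sub] at hy1
  -- up: the rectangle above the box, exit through the middle half of its bottom side;
  -- down: the rectangle below the box, exit through the middle half of its top side
  rcases hy1 with hy1 | hy1 <;>
    [refine exit_bottom ![z 0 - 24 * k, z 1 + 12 * k] (by omega) (by omega)
        (harm _ (fun v hv => ?_) (fun v hv hvB => ?_)) (fun w _ => hu0 w) zero_le_one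
        (fun w h1 h2 h3 => hbox w ?_ ?_ ?_ ?_) ?_ ?_ ?_ ?_;
     refine exit_top ![z 0 - 24 * k, z 1 - 48 * k] (by omega) (by omega)
        (harm _ (fun v hv => ?_) (fun v hv hvB => ?_)) (fun w _ => hu0 w) zero_le_one
        (fun w h1 h2 h3 => hbox w ?_ ?_ ?_ ?_) ?_ ?_ ?_ ?_] <;>
    simp only [rectInterior, mW, mB, Set.mem_setOf_eq, Matrix.cons_val_zero, Matrix.cons_val_one,
      abs_le] at * <;>
    push_cast at * <;>
    omega

/-- **Near the hub.** If `v` lies within sup-distance `24k` of `z` and both frames `mW z k`,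
`mW v k` are clean and inside `Λ`, then `hitProb_Λ(mB z k) ≥ exitConst 4 3 1 · c_*` on `mB v k`:
the column through `z` of half-height `36k` (hub box and its two arms, where the hitting
probability is `≥ exitConst 4 3 1` by `fatSite_arm`) blocks the top or the bottom strip of the
annulus of `v`, so the walk from `mB v k` hits it with probability `≥ c_*`
(`edgeSurvive_avoidGraph_le_of_strip`), and the strong Markov comparison concludes.
[cite: Chelkak2016, §3.2 (proof of Prop. 3.3)] -/
theorem fatSite_nearHub (hGr : Gr ≤ zdGraph 2) {Λ : Set (Site 2)} (hΛ : Λ.Finite) {k : ℕ} (hk : 0 < k)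
    {z v : Site 2} (hzW : mW z k ⊆ Λ) (hzclean : ∀ y ∈ mW z k, ∀ e : SRW.Dir 2, Gr.Adj y (y + SRW.stepVec e))
    (hvW : mW v k ⊆ Λ) (hvclean : ∀ y ∈ mW v k, ∀ e : SRW.Dir 2, Gr.Adj y (y + SRW.stepVec e))
    (h0 : |v 0 - z 0| ≤ 24 * k) (h1 : |v 1 - z 1| ≤ 24 * k) {y : Site 2} (hy : y ∈ mB v k) :
    exitConst 4 3 1 * maneuverConst ≤ hitProb Gr Λ (mB z k) y := by
  obtain ⟨hκa, hκ1⟩ := fatSite_exitConst_bounds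
  have hκ0 : 0 < exitConst 4 3 1 := lt_of_lt_of_le (by norm_num) hκa
  -- the column through `z` of half-height `36k`, inside the frame of `v`
  set B : Set (Site 2) := {w | (w 0 = z 0 ∧ |w 1 - z 1| ≤ 36 * k) ∧ w ∈ mW v k} with hB
  have hBval : ∀ w ∈ B, exitConst 4 3 1 ≤ hitProb Gr Λ (mB z k) w := by
    rintro w ⟨⟨hw0, hw1⟩, -⟩
    by_cases hle : |w 1 - z 1| ≤ 12 * k
    · rw [hitProb_of_mem (show w ∈ mB z k from ⟨by rw [hw0, sub_self, abs_zero]; positivity, hle⟩)]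
      exact hκ1
    · exact fatSite_arm hΛ hk hzW hzclean hw0 (lt_of_not_ge hle) hw1
  have hBW : B ⊆ mW v k := fun w hw => hw.2
  have h1' := one_sub_edgeSurvive_le_hitProb hΛ hBW hvW hvclean y (mB_subset_mW hy)
  rw [abs_le] at h0 h1
  -- the column blocks the top strip of the annulus of `v` if `v₁ ≤ z₁`, else its bottom strip
  have h2 : edgeSurvive (avoidGraph Gr B) (mW v k) y ≤ 1 - maneuverConst := by
    refine edgeSurvive_avoidGraph_le_of_strip hGr hk ?_ hy
    by_cases hvz : v 1 ≤ z 1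
    · refine Or.inl ⟨z 0, by omega, by omega, fun w hw hw1 hw2 => ?_⟩
      simp only [hB, Set.mem_setOf_eq, mW, abs_le]
      omega
    · refine Or.inr (Or.inr (Or.inl ⟨z 0, by omega, by omega, fun w hw hw1 hw2 => ?_⟩))
      simp only [hB, Set.mem_setOf_eq, mW, abs_le]
      omega
  have h3 := mul_hitProb_le_of_le_on hΛ hκ0 hκ1 hBval y
  calc exitConst 4 3 1 * maneuverConst ≤ exitConst 4 3 1 * hitProb Gr Λ B y := by
        gcongr; linarith
    _ ≤ _ := h3

/-- **Harnack comparability along a fat path, box centred at the endpoint.** The statement of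
`harnack_fatPath` with the confining box `sqBox b N` centred at the END `b` of the walk (same
proof: the cells of side `12k + 1` are those of `sqBox b N`). [cite: Chelkak2016, Proposition 3.3] -/
theorem fatSite_harnack_end (hGr : Gr ≤ zdGraph 2) {Λ : Set (Site 2)} {k : ℕ} (hk : 0 < k) (N : ℕ)
    {a b : Site 2} (ρ : Gr.Walk a b) (hbox : ∀ v ∈ ρ.support, v ∈ WeakBeurling.sqBox b N)
    (hΛ : ∀ v ∈ ρ.support, mW v k ⊆ Λ)
    (hclean : ∀ v ∈ ρ.support, ∀ w ∈ mW v k, ∀ e : SRW.Dir 2, Gr.Adj w (w + SRW.stepVec e))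
    {h : Site 2 → ℝ} (hpos : ∀ w, 0 ≤ h w) (hharm : IsKilledHarmonicOn Gr h Λ) :
    (maneuverConst / 2) ^ (2 * (N / (6 * k) + 2) ^ 2 + 2) * h a ≤ h b := by
  have hθ0 : (0 : ℝ) ≤ maneuverConst / 2 := by have := maneuverConst_pos; positivity
  have hθ1 : maneuverConst / 2 ≤ 1 := by have := maneuverConst_le_one; linarith
  -- the cell of a site: side `12k + 1`, origin at the corner `b - (N, N)` of `sqBox b N`
  let cell : Site 2 → ℕ × ℕ := fun v =>
    ((v 0 - b 0 + N).toNat / (12 * k + 1), (v 1 - b 1 + N).toNat / (12 * k + 1))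
  -- one Harnack factor between a path site and a site of the box in the same cell
  have one_box : ∀ v w : Site 2, v ∈ ρ.support → w ∈ WeakBeurling.sqBox b N → cell v = cell w →
      maneuverConst / 2 * h v ≤ h w := by
    intro v w hv hw hvw
    have hv' := hbox v hv
    rw [WeakBeurling.mem_sqBox, abs_le, abs_le] at hv' hw
    have e : ∀ x : ℤ, 0 ≤ x → ((x.toNat : ℕ) : ℤ) = x := fun x hx => Int.toNat_of_nonneg hx
    obtain ⟨e0, e1, f0, f1⟩ := And.intro (e (v 0 - b 0 + N) (by omega)) (And.intro (e (v 1 - b 1 + N) (by omega))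
      (And.intro (e (w 0 - b 0 + N) (by omega)) (e (w 1 - b 1 + N) (by omega))))
    have d0 := fatPath_sub_lt_of_div_eq (by omega) (congrArg Prod.fst hvw)
    have d1 := fatPath_sub_lt_of_div_eq (by omega) (congrArg Prod.snd hvw)
    have hwB : w ∈ mB v k := by
      constructor <;> rw [abs_le] <;> push_cast at d0 d1 ⊢ <;> constructor <;> omega
    exact harnack_box_killed v hk (hclean v hv) (hharm.mono (hΛ v hv)) hpos hwB
  -- one Harnack factor along an edge of the path
  have one_step : ∀ i, i < ρ.length →
      maneuverConst / 2 * h (ρ.getVert i) ≤ h (ρ.getVert (i + 1)) := by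
    intro i hi
    have hadj : Gr.Adj (ρ.getVert i) (ρ.getVert (i + 1)) := ρ.adj_getVert_succ hi
    have hv := ρ.getVert_mem_support i
    have hst := WeakBeurling.coord_step_of_adj (hGr hadj)
    have hwB : ρ.getVert (i + 1) ∈ mB (ρ.getVert i) k := by
      constructor <;> rw [abs_le] <;>
        rcases hst with ⟨h0, h1⟩ | ⟨h0, h1⟩ | ⟨h0, h1⟩ | ⟨h0, h1⟩ <;> constructor <;> omega
    exact harnack_box_killed _ hk (hclean _ hv) (hharm.mono (hΛ _ hv)) hpos hwB
  -- the chain bound with the cell labelling of the indices of `ρ`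
  have hchain := fatPath_chain_bound (fun i => cell (ρ.getVert i)) (fun i => h (ρ.getVert i))
    (maneuverConst / 2) ρ.length hθ0 hθ1 (fun i => hpos _)
    (fun i j _ _ hij => one_box _ _ (ρ.getVert_mem_support i) (hbox _ (ρ.getVert_mem_support j)) hij)
    one_step 0 (Nat.zero_le _)
  rw [ρ.getVert_zero, ρ.getVert_length] at hchain
  -- counting the cells of `sqBox b N`
  have hcount : ((Finset.Icc 0 ρ.length).image (fun i => cell (ρ.getVert i))).card
      ≤ (N / (6 * k) + 1) ^ 2 := by
    refine fatPath_card_image_le_sq _ _ _ fun i _ => ?_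
    have hv := hbox _ (ρ.getVert_mem_support i)
    rw [WeakBeurling.mem_sqBox, abs_le, abs_le] at hv
    exact ⟨fatPath_toNat_div_le hk (by omega), fatPath_toNat_div_le hk (by omega)⟩
  have hsq : (N / (6 * k) + 1) ^ 2 ≤ (N / (6 * k) + 2) ^ 2 := Nat.pow_le_pow_left (by omega) 2
  calc (maneuverConst / 2) ^ (2 * (N / (6 * k) + 2) ^ 2 + 2) * h a
      ≤ (maneuverConst / 2) ^ (2 * ((Finset.Icc 0 ρ.length).image (fun i => cell (ρ.getVert i))).card)
          * h a :=
        mul_le_mul_of_nonneg_right (pow_le_pow_of_le_one hθ0 hθ1 (by omega)) (hpos _)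
    _ ≤ h b := hchain


/-- **Hitting the hub box from a fat site** (Chelkak's Harnack chain for hitting
probabilities, counted by packing). Along a kept walk `π` from the hub centre `z` to `w` inside
`sqBox z N`, all of whose sites carry clean frames, `hitProb_Λ(mB z k)(w) ≥ (c_*/2)^E`,
`E = 2 (N/(6k) + 2)² + 2`. Proof: by strong induction on the index `t`,
`hitProb ≥ κ c_*^{n(t)}` on `mB (π t) k`, where `κ = exitConst 4 3 1 · c_*` and `n(t)` is the
number of cells of side `24k` met by `π[0, t]`: near the hub (`|π t - z|_∞ ≤ 24k`) this is
`fatSite_nearHub`; otherwise the first index `t'` with `|π t' - π t|_∞ ≤ 24k` is at sup-distance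
exactly `24k` (coordinates move by one along `π`), so `ChainStep (π t') (π t) k` and
`hitProb_chain_step` costs one factor `c_*`, while the cell of `π t` is not among the cells of
`π[0, t']` (all those sites are at sup-distance `≥ 24k` from `π t`), so `n(t') + 1 ≤ n(t)`. Finally
`n ≤ (N/(12k) + 1)²`, and `E ≥ n + 1`, `E ≥ 10`, `2^{-10} ≤ exitConst 4 3 1`.
[cite: Chelkak2016, Proposition 3.3] -/
theorem fatSite_hubHit (hGr : Gr ≤ zdGraph 2) {Λ : Set (Site 2)} (hΛ : Λ.Finite) {k : ℕ} (hk : 0 < k)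
    (N : ℕ) {z w : Site 2} (π : Gr.Walk z w) (hbox : ∀ v ∈ π.support, v ∈ WeakBeurling.sqBox z N)
    (hΛW : ∀ v ∈ π.support, mW v k ⊆ Λ)
    (hclean : ∀ v ∈ π.support, ∀ y ∈ mW v k, ∀ e : SRW.Dir 2, Gr.Adj y (y + SRW.stepVec e)) :
    (maneuverConst / 2) ^ (2 * (N / (6 * k) + 2) ^ 2 + 2) ≤ hitProb Gr Λ (mB z k) w := by
  set u := hitProb Gr Λ (mB z k) with hu
  obtain ⟨hκa, hκb⟩ := fatSite_exitConst_bounds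
  have hc0 := maneuverConst_pos
  have hc1 := maneuverConst_le_one
  set κ := exitConst 4 3 1 * maneuverConst with hκ
  have hκ0 : 0 < κ := mul_pos (by linarith) hc0
  have hκ1 : κ ≤ 1 := mul_le_one₀ hκb hc0.le hc1
  have hz0 : π.getVert 0 = z := π.getVert_zero
  -- cells of side `24k`, origin at the corner `z - (N, N)` of `sqBox z N`
  let cell : Site 2 → ℕ × ℕ := fun y =>
    ((y 0 - z 0 + N).toNat / (24 * k), (y 1 - z 1 + N).toNat / (24 * k))
  let n : ℕ → ℕ := fun t => ((Finset.range (t + 1)).image fun i => cell (π.getVert i)).card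
  -- two path sites in one cell are within sup-distance `< 24k`
  have hcell : ∀ i j, cell (π.getVert i) = cell (π.getVert j) →
      |π.getVert i 0 - π.getVert j 0| < 24 * k ∧ |π.getVert i 1 - π.getVert j 1| < 24 * k := by
    intro i j hij
    obtain ⟨hi, hj⟩ := And.intro (hbox _ (π.getVert_mem_support i)) (hbox _ (π.getVert_mem_support j))
    rw [WeakBeurling.mem_sqBox, abs_le, abs_le] at hi hj
    have e : ∀ x : ℤ, 0 ≤ x → ((x.toNat : ℕ) : ℤ) = x := fun x hx => Int.toNat_of_nonneg hx
    have e0 := e (π.getVert i 0 - z 0 + N) (by omega)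
    have e1 := e (π.getVert i 1 - z 1 + N) (by omega)
    have f0 := e (π.getVert j 0 - z 0 + N) (by omega)
    have f1 := e (π.getVert j 1 - z 1 + N) (by omega)
    have d0 := fatPath_sub_lt_of_div_eq (by omega) (congrArg Prod.fst hij)
    have d1 := fatPath_sub_lt_of_div_eq (by omega) (congrArg Prod.snd hij)
    push_cast at d0 d1
    rw [abs_lt, abs_lt]; exact ⟨⟨by omega, by omega⟩, ⟨by omega, by omega⟩⟩
  -- the main claim, by strong induction on the index
  have key : ∀ t, t ≤ π.length → ∀ y ∈ mB (π.getVert t) k, κ * maneuverConst ^ n t ≤ u y := by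
    intro t
    induction t using Nat.strong_induction_on with
    | _ t ih =>
    intro ht y hy
    by_cases hnear : |π.getVert t 0 - z 0| ≤ 24 * k ∧ |π.getVert t 1 - z 1| ≤ 24 * k
    · -- near the hub
      have h := fatSite_nearHub hGr hΛ hk (hΛW _ π.start_mem_support) (hclean _ π.start_mem_support)
        (hΛW _ (π.getVert_mem_support t)) (hclean _ (π.getVert_mem_support t)) hnear.1 hnear.2 hy
      calc κ * maneuverConst ^ n t ≤ κ * 1 := by gcongr; exact pow_le_one₀ hc0.le hc1
        _ ≤ u y := by rw [mul_one]; exact h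
    · -- far from the hub: the first index within sup-distance `24k` of `π t`
      have hPt : |π.getVert t 0 - π.getVert t 0| ≤ 24 * k ∧ |π.getVert t 1 - π.getVert t 1| ≤ 24 * k := by
        constructor <;> rw [sub_self, abs_zero] <;> positivity
      have hex : ∃ i, |π.getVert i 0 - π.getVert t 0| ≤ 24 * k ∧ |π.getVert i 1 - π.getVert t 1| ≤ 24 * k :=
        ⟨t, hPt⟩
      have hPt' := Nat.find_spec hex
      have ht't : Nat.find hex ≤ t := Nat.find_min' hex hPt
      have hne : Nat.find hex ≠ 0 := by
        intro h0
        rw [h0, hz0, abs_sub_comm (z 0), abs_sub_comm (z 1)] at hPt'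
        exact hnear hPt'
      obtain ⟨s, hs⟩ : ∃ s, Nat.find hex = s + 1 := Nat.exists_eq_succ_of_ne_zero hne
      rw [hs] at hPt' ht't
      have hPs : ¬(|π.getVert s 0 - π.getVert t 0| ≤ 24 * k ∧ |π.getVert s 1 - π.getVert t 1| ≤ 24 * k) :=
        Nat.find_min hex (by omega)
      have hadj : Gr.Adj (π.getVert s) (π.getVert (s + 1)) := π.adj_getVert_succ (by omega)
      have hst := WeakBeurling.coord_step_of_adj (hGr hadj)
      rw [abs_le, abs_le] at hPt'
      rw [abs_le, abs_le] at hPs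
      -- `s + 1 < t`: otherwise `π s`, adjacent to `π t`, would be within `24k`
      have hlt : s + 1 < t := by
        rcases ht't.eq_or_lt with h | h
        · exfalso; apply hPs; rw [← h]
          rcases hst with ⟨h0, h1⟩ | ⟨h0, h1⟩ | ⟨h0, h1⟩ | ⟨h0, h1⟩ <;> omega
        · exact h
      -- the step is admissible: sup-distance exactly `24k`
      have hstep : ChainStep (π.getVert (s + 1)) (π.getVert t) k := by
        unfold ChainStep
        rw [abs_le, abs_le]
        rcases hst with ⟨h0, h1⟩ | ⟨h0, h1⟩ | ⟨h0, h1⟩ | ⟨h0, h1⟩ <;> omega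
      have hθ := ih (s + 1) hlt (by omega)
      have hcs := hitProb_chain_step hGr hΛ hk hstep (hΛW _ (π.getVert_mem_support t))
        (hclean _ (π.getVert_mem_support t)) (θ := κ * maneuverConst ^ n (s + 1)) (by positivity)
        (mul_le_one₀ hκ1 (by positivity) (pow_le_one₀ hc0.le hc1)) hθ hy
      -- the cell of `π t` is new: `n (s + 1) + 1 ≤ n t`
      have hn : n (s + 1) + 1 ≤ n t := by
        have hnotin : cell (π.getVert t) ∉ (Finset.range (s + 1 + 1)).image fun i => cell (π.getVert i) := by
          intro hmem
          obtain ⟨i, hi, hci⟩ := Finset.mem_image.1 hmem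
          rw [Finset.mem_range] at hi
          have hc := hcell i t hci
          rw [abs_lt, abs_lt] at hc
          rcases (show i < s + 1 ∨ i = s + 1 by omega) with hi' | rfl
          · refine Nat.find_min hex (by omega : i < Nat.find hex) ⟨?_, ?_⟩ <;> rw [abs_le] <;>
              constructor <;> omega
          · unfold ChainStep at hstep
            rw [abs_le, abs_le] at hstep
            omega
        have hsub : insert (cell (π.getVert t)) ((Finset.range (s + 1 + 1)).image fun i => cell (π.getVert i))
            ⊆ (Finset.range (t + 1)).image fun i => cell (π.getVert i) := by
          rw [Finset.insert_subset_iff]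
          exact ⟨Finset.mem_image.2 ⟨t, Finset.mem_range.2 (by omega), rfl⟩,
            Finset.image_subset_image (Finset.range_subset_range.2 (by omega))⟩
        have := Finset.card_le_card hsub
        rw [Finset.card_insert_of_notMem hnotin] at this
        exact this
      calc κ * maneuverConst ^ n t ≤ κ * maneuverConst ^ (n (s + 1) + 1) :=
            mul_le_mul_of_nonneg_left (pow_le_pow_of_le_one hc0.le hc1 hn) hκ0.le
        _ = maneuverConst * (κ * maneuverConst ^ n (s + 1)) := by ring
        _ ≤ u y := hcs
  -- at the endpoint
  have hw := key π.length le_rfl w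
    (by rw [π.getVert_length]; constructor <;> rw [sub_self, abs_zero] <;> positivity)
  -- counting the cells of `sqBox z N`
  have hcount : n π.length ≤ (N / (12 * k) + 1) ^ 2 := by
    refine fatPath_card_image_le_sq _ _ _ fun i _ => ?_
    have hv := hbox _ (π.getVert_mem_support i)
    rw [WeakBeurling.mem_sqBox, abs_le, abs_le] at hv
    have aux : ∀ x : ℤ, x ≤ 2 * N → x.toNat / (24 * k) ≤ N / (12 * k) := fun x hx => by
      have h1 : x.toNat ≤ 2 * N := by rw [Int.toNat_le]; exact_mod_cast hx
      calc x.toNat / (24 * k) ≤ 2 * N / (24 * k) := Nat.div_le_div_right h1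
        _ = 2 * N / (2 * (12 * k)) := by ring_nf
        _ = N / (12 * k) := Nat.mul_div_mul_left N (12 * k) two_pos
    exact ⟨aux _ (by omega), aux _ (by omega)⟩
  -- exponent bookkeeping: `E ≥ n + 1` and `E ≥ 10`
  have hq : N / (12 * k) ≤ N / (6 * k) := Nat.div_le_div_left (by omega) (by omega)
  have hE1 : n π.length + 1 ≤ 2 * (N / (6 * k) + 2) ^ 2 + 2 := by
    have := Nat.pow_le_pow_left (show N / (12 * k) + 1 ≤ N / (6 * k) + 2 by omega) 2; omega
  have hE2 : 10 ≤ 2 * (N / (6 * k) + 2) ^ 2 + 2 := by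
    have := Nat.pow_le_pow_left (Nat.le_add_left 2 (N / (6 * k))) 2; omega
  calc (maneuverConst / 2) ^ (2 * (N / (6 * k) + 2) ^ 2 + 2)
      = maneuverConst ^ (2 * (N / (6 * k) + 2) ^ 2 + 2) * (1 / 2) ^ (2 * (N / (6 * k) + 2) ^ 2 + 2) := by
        rw [div_eq_mul_one_div, mul_pow]
    _ ≤ maneuverConst ^ (n π.length + 1) * (1 / 2) ^ 10 :=
        mul_le_mul (pow_le_pow_of_le_one hc0.le hc1 hE1) (pow_le_pow_of_le_one (by norm_num) (by norm_num) hE2)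
          (by positivity) (by positivity)
    _ ≤ maneuverConst ^ (n π.length + 1) * exitConst 4 3 1 := by
        gcongr; norm_num at hκa ⊢; exact hκa
    _ = κ * maneuverConst ^ n π.length := by rw [hκ]; ring
    _ ≤ u w := hw

/-- **Fat wall sites are good.** See the module docstring. [cite: Chelkak2016, Proposition 3.3] -/
theorem fatSite_good :
    ∀ (Gr : SimpleGraph (Site 2)), Gr ≤ zdGraph 2 → ∀ (Λ : Set (Site 2)), Λ.Finite →
      ∀ (k : ℕ), 0 < k → ∀ (N : ℕ) {z w : Site 2} (π : Gr.Walk z w),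
      (∀ v ∈ π.support, v ∈ WeakBeurling.sqBox z N) → (∀ v ∈ π.support, mW v k ⊆ Λ) →
      (∀ v ∈ π.support, ∀ y ∈ mW v k, ∀ e : SRW.Dir 2, Gr.Adj y (y + SRW.stepVec e)) →
      ∀ x : Site 2, x ∉ Λ →
        killedPoisson Gr Λ w x * (maneuverConst / 2) ^ (2 * (N / (6 * k) + 2) ^ 2 + 2) ≤ killedPoisson Gr Λ z x ∧
        (maneuverConst / 2) ^ (2 * (N / (6 * k) + 2) ^ 2 + 2) ≤ hitProb Gr Λ (mB z k) w ∧
        killedPoisson Gr Λ w x ≤ ((2 / maneuverConst) ^ (2 * (N / (6 * k) + 2) ^ 2 + 2)) ^ 2 *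
          killedPoisson Gr Λ z x * hitProb Gr Λ (mB z k) w := by
  intro Gr hGr Λ hΛ k hk N z w π hbox hΛW hclean x _
  have hc0 := maneuverConst_pos
  set A := (maneuverConst / 2) ^ (2 * (N / (6 * k) + 2) ^ 2 + 2) with hA
  have hA0 : 0 < A := by positivity
  -- (i) Harnack along the reversed walk `w → z`, the box `sqBox z N` being centred at its endpoint
  have hi : A * killedPoisson Gr Λ w x ≤ killedPoisson Gr Λ z x := by
    have hmem : ∀ v, v ∈ π.reverse.support → v ∈ π.support := fun v hv => by
      rwa [SimpleGraph.Walk.support_reverse, List.mem_reverse] at hv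
    exact fatSite_harnack_end hGr hk N π.reverse (fun v hv => hbox v (hmem v hv))
      (fun v hv => hΛW v (hmem v hv)) (fun v hv => hclean v (hmem v hv))
      (h := fun v => killedPoisson Gr Λ v x) (fun v => killedPoisson_nonneg hΛ v x)
      (killedPoisson_harmonicOn hΛ x)
  -- (ii) the hub box is hit from `w` with probability `≥ A`
  have hii : A ≤ hitProb Gr Λ (mB z k) w := fatSite_hubHit hGr hΛ hk N π hbox hΛW hclean
  refine ⟨by rw [mul_comm]; exact hi, hii, ?_⟩
  -- (iii) `P(w,x) ≤ A⁻¹ P(z,x) · 1 ≤ A⁻¹ P(z,x) · A⁻¹ hitProb(w)`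
  have hinv : (2 / maneuverConst) ^ (2 * (N / (6 * k) + 2) ^ 2 + 2) = A⁻¹ := by
    rw [hA, ← inv_pow, inv_div]
  rw [hinv]
  have hPz := killedPoisson_nonneg (Gr := Gr) hΛ z x
  have hA1 : A ≠ 0 := hA0.ne'
  calc killedPoisson Gr Λ w x = A⁻¹ ^ 2 * (A * killedPoisson Gr Λ w x) * A := by field_simp
    _ ≤ A⁻¹ ^ 2 * killedPoisson Gr Λ z x * A := by gcongr
    _ ≤ A⁻¹ ^ 2 * killedPoisson Gr Λ z x * hitProb Gr Λ (mB z k) w :=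
        mul_le_mul_of_nonneg_left hii (mul_nonneg (by positivity) hPz)

end Summit.CriticalPhenomena.SAWScalingLimit.Theorems.AvoidanceLimit.Anchor

end
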